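/-
Copyright: cell pub-balaban-gaps (YM BLITZ Y1, track G1), seat g1-p2 GEN 8 (unit `pub-balaban-gaps-g1-p2`).  Row (D4) NODE O,
JUNCTION J-3 (multi-level), THE STEP: the genuine MULTI-LEVEL flat propagator `G′ = Δ′_a^{−1}` of [4] Prop. 2.2 (nested domains
`T_η ⊃ Ω₁ ⊃ … ⊃ Ω_k`), in print's units `η²G′` with `∇^η = η⁻¹∂`, carries the VALUE and DERIVATIVE letters of the (D4) block
currency UNIFORMLY in `k`, the torus and the family (`D4WalkBlockFlatLettersMultiLevel`); hence it is a one-term block walk expansion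
with derivative letters and [B9] Cor. 3.5's step AT `U = 1` applies to it: for every (3.61)-dominated holomorphic perturbation `V`,
`η²G′(1 − V·η²G′)⁻¹` is a block walk expansion with the same derivative letters — constants uniform in `k`, the torus, `{Ω_j}`.
HONEST FRAMING: the operator is the tree's scalar model (`m² = 0`, `Ω₁ = T_η`); `V` is a hypothesis SHAPE (Bałaban's `V′(A)` NOT
constructed); (D4) NOT discharged (instance 0∕1); NOT BetaPertH, NOT continuum, NOT Clay.
-/
import Summits.QuantumFields.BalabanUV.Gaps.D4WalkBlockFlatLettersMultiLevel
import Summits.QuantumFields.BalabanUV.Gaps.D4WalkBlockDerivative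

/-!
# `Gaps.D4WalkBlockFlatMultiLevel` — junction J-3 (multi-level), the step: print-unit letters of the genuine multi-level flat
# propagator, its one-term block walk expansion with derivative letters, and [B9] Cor. 3.5's step at `U = 1` on it
# (cell pub-balaban-gaps, seat g1-p2 gen 8)

HONEST DEPENDENCY (cell pub-balaban, verbatim): continuum YM on T⁴ ⇐ BetaPertH ∧ nine spine estimates (0/9 proved);
BetaPertH ⇐ (D1) ∧ (D4) ∧ CAP+tail.

[B9] p. 399: «This way the theorems are reduced to the corresponding theorems for propagators without external gauge field. They
were proved in [4].» — [4] Prop. 2.2 is the MULTI-LEVEL statement (domains `{Ω_j}`, blocks `B^j(y)`, `y ∈ Λ_j`); the one-scale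
member was junctioned in `D4WalkBlockFlatLetters` ∕ `D4WalkBlockFlatOneScale` (57a∕57b), the general member's letters in
`D4WalkBlockFlatLettersMultiLevel.flatLetters_multiLevelTorus` (lattice units).  THIS FILE:
* §1 `blockNorm_smul_mul_smul_le`: scaling bookkeeping (`‖(a•A)(b•B)‖ ≤ ‖ab‖·‖AB‖`);
  **`flatLetters_multiLevelTorus_printUnits`** — with `η = L^{−k}`, `W := η²·(G′.map ofReal)` and `∇c_μ := η⁻¹·(∂_μ.map ofReal)`:
  `‖W‖_{Y,Y′} ≤ C·e^{−δ₁d₁(Y,Y′)}` and `‖∇c_μ·W‖_{Y,Y′} ≤ C·e^{−δ₁d₁(Y,Y′)}` for all top cubes — the VALUE letter and the DERIVATIVE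
  letter (relative factor `1`) of `D4WalkBlockDerivative`, NO constant depending on `k`, the torus, `{Ω_j}` or `‖∇c‖ = O(L^k)`;
* §2 **`blockWalkExpansion_flatPerturb_multiLevelTorus`** — [B9] COR. 3.5's STEP AT `U = 1` ON THE GENUINE MULTI-LEVEL FLAT
  OPERATOR: ∃ `δ₁, C, M₀, N₀` (functions of `d, ℓ`, windows) such that for every admissible `(k, M_h, R, P, D, a, c, Kc)` as in
  `flatLetters_multiLevelTorus`, every σ-independent entrywise-holomorphic `V(u)` on a ball with the (3.61)-shape domination letter
  `‖V(u)S‖_{Y,Y′} ≤ α₀‖S‖ + Σ_μ α_μ‖∇c_μS‖` (`α ≥ 0`), every cube row sum `(μ, c_μ)`, rates `0 ≤ μ`, `2μ ≤ ε`, `2μ ≤ δ₁ − ε − μ`, and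
  the MARGIN `c_μ(c_μ·1·(1·((α₀ + Σ_μ α_μ·1)C))c_μ)c_μ < 1` («α₁ sufficiently small» against `(C, c_μ)` ONLY): `W(1 − V(u)W)⁻¹` is a
  block walk expansion at `(ε − 2μ, δ₁ − ε − 3μ)`, walk rate `δ₁ − 2μ`, constant `c_μC(1·(1−q)⁻¹)c_μ`, dominating distances, relative
  derivative letters `1` (= `D4WalkBlockDerivative.blockWalkExpansion_perturb_of_derivLetters` on the one-term expansion
  `D4WalkBlockFlatLetters.blockWalkExpansion_const` of `W`).
WHAT IT IS NOT.  Bałaban's `V′(A)`; the covariant multi-level objects; the s-decoration ∕ `G′(□)`; Hölder∕Laplacian entries; a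
multi-level walk geometry (the expansion lives on the TOP cube torus); (D4) instance 0∕1; words of row (D4) UNCHANGED.

References: T. Bałaban, Comm. Math. Phys. **96** (1984) 223–250 [4], Prop. 2.2 (2.67) p. 234, p. 224; Comm. Math. Phys. **99** (1985)
389–434 [B9], p. 399, (3.60)–(3.65) pp. 402–403, Cor. 3.5 p. 407, Thm 3.1 (3.42) p. 397, (3.107)–(3.108) p. 416; Comm. Math. Phys.
**116** (1988) 1–22 [II], (1.11) p. 5.
-/

noncomputable section

namespace Summit.QuantumFields.BalabanUV.Gaps.D4WalkBlockFlatMultiLevel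

open Finset Metric
open scoped Matrix
open Literature.MathematicalPhysics.QuantumFieldTheory.Balaban1983to89
open Literature.MathematicalPhysics.QuantumFieldTheory.Balaban1983to89.B4Reflection242 (boxDom)
open Literature.MathematicalPhysics.QuantumFieldTheory.Balaban1983to89.B9SectDWalk (DomBy)
open Literature.MathematicalPhysics.QuantumFieldTheory.Balaban1983to89.B9Thm34Ext (toB6)
open Literature.MathematicalPhysics.QuantumFieldTheory.Balaban1983to89.B9Thm37GlueTorus (torusGeom tdist1 tdist1_nonneg)
open Literature.MathematicalPhysics.QuantumFieldTheory.Balaban1983to89.TreeLengthTorus (TPt)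
open Literature.MathematicalPhysics.QuantumFieldTheory.Balaban1983to89.B5TorusCover (UT)
open Literature.MathematicalPhysics.QuantumFieldTheory.Balaban1983to89.B11SectG (RowSum)
open Literature.MathematicalPhysics.QuantumFieldTheory.Balaban1983to89.B6MultiLevelBoxOperator (N0)
open Literature.MathematicalPhysics.QuantumFieldTheory.Balaban1983to89.B6MultiLevelTorusOperator (TDomains gmlT)
open Literature.MathematicalPhysics.QuantumFieldTheory.Balaban1983to89.B6Ineq243TwoLevelBox (aNext)
open Literature.MathematicalPhysics.QuantumFieldTheory.Balaban1983to89.B6Prop22DerivMultiLevelTorus (dT)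
open Summit.QuantumFields.BalabanUV.Gaps.D4WalkBlock (blockNorm blockNorm_nonneg blockNorm_smul_le BlockWalkExpansion)
open Summit.QuantumFields.BalabanUV.Gaps.D4WalkBlockDerivative (blockWalkExpansion_perturb_of_derivLetters)
open Summit.QuantumFields.BalabanUV.Gaps.D4WalkBlockFlatLetters (blockWalkExpansion_const map_ofReal_mul)
open Summit.QuantumFields.BalabanUV.Gaps.D4WalkBlockMultiLevelGeometry (cubeML)
open Summit.QuantumFields.BalabanUV.Gaps.D4WalkBlockFlatLettersMultiLevel (flatLetters_multiLevelTorus)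

variable {d : ℕ}

/-! ## §1. Print's units: `W = η²G′`, `∇c_μ = η⁻¹∂_μ` — both letters `C·e^{−δ₁d₁}`, k-uniform -/

section PrintUnits

variable {ν : ℕ} {K : Fin ν → ℕ} {p : Type} [Fintype p]

/-- Scaling bookkeeping: `‖(a•A)(b•B)‖_{Y,Y′} ≤ ‖a·b‖·‖AB‖_{Y,Y′}`. -/
theorem blockNorm_smul_mul_smul_le (cub : p → UT K) (a b : ℂ) (A B : Matrix p p ℂ) (Y Y' : UT K) :
    blockNorm cub cub (a • A * (b • B)) Y Y' ≤ ‖a * b‖ * blockNorm cub cub (A * B) Y Y' := by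
  rw [Matrix.smul_mul, Matrix.mul_smul, smul_smul]
  exact blockNorm_smul_le cub cub (a * b) (A * B) Y Y'

/-- **THE MULTI-LEVEL FLAT LETTERS IN PRINT'S UNITS — VALUE AND DERIVATIVE `C·e^{−δ₁d₁}`, NO `k`.**  With `η = L^{−k}`,
`W = η²·(G′.map ofReal)` (`G′ = gmlT = Δ′_a^{−1}` of [4] on the nested family `D`) and `∇c_μ = η⁻¹·(∂_μ.map ofReal)`: for all top cubes
`‖W‖_{Y,Y′} ≤ C·e^{−δ₁d₁(Y,Y′)}` and `‖∇c_μ·W‖_{Y,Y′} ≤ C·e^{−δ₁d₁(Y,Y′)}` — `(δ₁, C, M₀, N₀)` functions of `d, ℓ` and the windows only.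
[cite: Balaban1984PropagatorsII, Prop. 2.2 (2.67) p.234 («O(1)[(L^jη)², (L^jη)]»), p.224; Balaban1985BackgroundPropagators, Thm 3.1 (3.42) p.397, p.399] -/
theorem flatLetters_multiLevelTorus_printUnits (d ℓ : ℕ) (hℓ : 1 ≤ ℓ) (aminus aplus a2minus a2plus : ℝ) (ha : 0 < aminus)
    (ha2 : 0 < a2minus) :
    ∃ δ₁ C M₀ : ℝ, ∃ N₀ : ℕ, 0 < δ₁ ∧ 0 < C ∧ 0 < M₀ ∧ 0 < N₀ ∧
      ∀ (k Mh R : ℕ), 3 ≤ Mh → M₀ ≤ ((ℓ : ℝ) + 1) * Mh → 2 * (ℓ + 1) ≤ R → N₀ + 1 ≤ R * ((ℓ + 1) * Mh) →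
      ∀ (P : Fin (d + 1) → ℕ) (hP : ∀ μ, 1 ≤ P μ) (hP4 : ∀ μ, 4 ≤ P μ) (D : TDomains d ℓ Mh k P R) (a c : ℕ → ℝ),
        (∀ i, 1 ≤ i → aminus ≤ a i ∧ a i ≤ aplus) → (∀ i, 1 ≤ i → a2minus ≤ c i ∧ c i ≤ a2plus) →
        (∀ i, 1 ≤ i → a (i + 1) = aNext ℓ (a i) (c i)) →
      ∀ (Kc : Fin (d + 1) → ℕ) [∀ i, NeZero (Kc i)], (∀ i, N0 ℓ Mh k P i = (ℓ + 1) ^ k * Kc i) →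
      ∀ Y Y' : UT Kc,
        blockNorm (fun x : ↥(boxDom (N0 ℓ Mh k P)) => cubeML ℓ k Kc x.1)
            (fun x : ↥(boxDom (N0 ℓ Mh k P)) => cubeML ℓ k Kc x.1)
            (((((ℓ : ℂ) + 1) ^ (2 * k))⁻¹ : ℂ) • (gmlT (N0 ℓ Mh k P) ℓ k D.lev a).map ((↑) : ℝ → ℂ)) Y Y' ≤
          C * Real.exp (-(δ₁ * tdist1 Kc Y Y')) ∧
        ∀ μ : Fin (d + 1),
          blockNorm (fun x : ↥(boxDom (N0 ℓ Mh k P)) => cubeML ℓ k Kc x.1)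
              (fun x : ↥(boxDom (N0 ℓ Mh k P)) => cubeML ℓ k Kc x.1)
              ((((ℓ : ℂ) + 1) ^ k : ℂ) • (dT (N0 ℓ Mh k P) μ).map ((↑) : ℝ → ℂ) *
                ((((((ℓ : ℂ) + 1) ^ (2 * k))⁻¹ : ℂ) • (gmlT (N0 ℓ Mh k P) ℓ k D.lev a).map ((↑) : ℝ → ℂ)))) Y Y' ≤
            C * Real.exp (-(δ₁ * tdist1 Kc Y Y')) := by
  obtain ⟨δ₁, C, M₀, N₀, hδ₁, hC, hM₀, hN₀, h⟩ := flatLetters_multiLevelTorus d ℓ hℓ aminus aplus a2minus a2plus ha ha2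
  refine ⟨δ₁, C, M₀, N₀, hδ₁, hC, hM₀, hN₀, ?_⟩
  intro k Mh R hMh hM hR hRM P hP hP4 D a c haw hcw hac Kc _ hKc Y Y'
  obtain ⟨hval, hder⟩ := h k Mh R hMh hM hR hRM P hP hP4 D a c haw hcw hac Kc hKc Y Y'
  have hL0 : (0 : ℝ) < (ℓ : ℝ) + 1 := by positivity
  have hLC : ‖((ℓ : ℂ) + 1)‖ = (ℓ : ℝ) + 1 := by
    rw [show ((ℓ : ℂ) + 1) = (((ℓ : ℝ) + 1 : ℝ) : ℂ) by push_cast; ring, Complex.norm_real, Real.norm_eq_abs,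
      abs_of_pos hL0]
  have hexp0 : 0 ≤ Real.exp (-(δ₁ * tdist1 Kc Y Y')) := (Real.exp_pos _).le
  refine ⟨?_, fun μ => ?_⟩
  · refine (blockNorm_smul_le _ _ _ _ Y Y').trans ?_
    rw [norm_inv, norm_pow, hLC]
    have hpow : (0 : ℝ) < ((ℓ : ℝ) + 1) ^ (2 * k) := by positivity
    calc (((ℓ : ℝ) + 1) ^ (2 * k))⁻¹ * blockNorm (fun x : ↥(boxDom (N0 ℓ Mh k P)) => cubeML ℓ k Kc x.1)
          (fun x : ↥(boxDom (N0 ℓ Mh k P)) => cubeML ℓ k Kc x.1) ((gmlT (N0 ℓ Mh k P) ℓ k D.lev a).map ((↑) : ℝ → ℂ)) Y Y'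
        ≤ (((ℓ : ℝ) + 1) ^ (2 * k))⁻¹ * (C * ((ℓ : ℝ) + 1) ^ (2 * k) * Real.exp (-(δ₁ * tdist1 Kc Y Y'))) :=
          mul_le_mul_of_nonneg_left hval (by positivity)
      _ = C * Real.exp (-(δ₁ * tdist1 Kc Y Y')) := by field_simp
  · refine (blockNorm_smul_mul_smul_le _ _ _ _ _ Y Y').trans ?_
    rw [← map_ofReal_mul, norm_mul, norm_inv, norm_pow, norm_pow, hLC]
    have hsc : ((ℓ : ℝ) + 1) ^ k * (((ℓ : ℝ) + 1) ^ (2 * k))⁻¹ = (((ℓ : ℝ) + 1) ^ k)⁻¹ := by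
      rw [pow_mul', sq]; field_simp
    rw [hsc]
    calc (((ℓ : ℝ) + 1) ^ k)⁻¹ * blockNorm (fun x : ↥(boxDom (N0 ℓ Mh k P)) => cubeML ℓ k Kc x.1)
          (fun x : ↥(boxDom (N0 ℓ Mh k P)) => cubeML ℓ k Kc x.1)
          ((dT (N0 ℓ Mh k P) μ * gmlT (N0 ℓ Mh k P) ℓ k D.lev a).map ((↑) : ℝ → ℂ)) Y Y'
        ≤ (((ℓ : ℝ) + 1) ^ k)⁻¹ * (C * ((ℓ : ℝ) + 1) ^ k * Real.exp (-(δ₁ * tdist1 Kc Y Y'))) :=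
          mul_le_mul_of_nonneg_left (hder μ) (by positivity)
      _ = C * Real.exp (-(δ₁ * tdist1 Kc Y Y')) := by field_simp

end PrintUnits

/-! ## §2. [B9] Cor. 3.5's step at `U = 1` on the genuine multi-level flat operator -/

section Step

variable {dd N' : ℕ} {E : Type*} [NormedAddCommGroup E] [NormedSpace ℂ E]

/-- **[B9] COR. 3.5's STEP AT `U = 1` ON THE GENUINE MULTI-LEVEL FLAT PROPAGATOR — UNIFORM IN `k`, THE TORUS AND `{Ω_j}`.**  There
are `δ₁, C, M₀ > 0`, `N₀ ≥ 1` (functions of `d, ℓ` and the weight windows only) such that for every admissible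
`(k, M_h, R, P, D, a, c)` of [4] Prop. 2.2 on the torus and every cube torus `UT Kc` of the top blocks (`N₀_μ = L^k·Kc_μ`), with
`W = η²·(G′.map ofReal)` and `∇c_μ = η⁻¹·(∂_μ.map ofReal)` (`η = L^{−k}`): for every σ-independent entrywise-holomorphic perturbation
`V(u)` on a ball with the (3.61)-shape domination letter `‖V(u)S‖_{Y,Y′} ≤ α₀‖S‖_{Y,Y′} + Σ_μ α_μ‖∇c_μS‖_{Y,Y′}` (`α ≥ 0`), every
cube row sum `(μ, c_μ)`, rates `0 ≤ μ`, `2μ ≤ ε`, `2μ ≤ δ₁ − ε − μ`, and the MARGIN `c_μ(c_μ·1·(1·((α₀ + Σ_μ α_μ·1)C))c_μ)c_μ < 1`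
(«α₁ sufficiently small» against `(C, c_μ)` ONLY): `W(1 − V(u)W)⁻¹` — the walk-expansion content of (3.64) — is a block walk
expansion at `(ε − 2μ, δ₁ − ε − 3μ)`, walk rate `δ₁ − 2μ`, constant `c_μC(1·(1−q)⁻¹)c_μ`, with dominating distances and the relative
derivative letters `1` for the `∇c_μ`; no constant depends on `k`, the torus, the family `{Ω_j}` or `‖∇c‖ = O(L^k)`.
[cite: Balaban1985BackgroundPropagators, Cor. 3.5 p.407, (3.60)–(3.65) pp.402–403, p.399, Thm 3.1 (3.42) p.397, (3.107)–(3.108) p.416; Balaban1984PropagatorsII, Prop. 2.2 (2.67) p.234, p.224; Balaban1988RG2Cluster, (1.11) p.5] -/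
theorem blockWalkExpansion_flatPerturb_multiLevelTorus (d ℓ : ℕ) (hℓ : 1 ≤ ℓ) (aminus aplus a2minus a2plus : ℝ)
    (ha : 0 < aminus) (ha2 : 0 < a2minus) :
    ∃ δ₁ C M₀ : ℝ, ∃ N₀ : ℕ, 0 < δ₁ ∧ 0 < C ∧ 0 < M₀ ∧ 0 < N₀ ∧
      ∀ (k Mh R : ℕ), 3 ≤ Mh → M₀ ≤ ((ℓ : ℝ) + 1) * Mh → 2 * (ℓ + 1) ≤ R → N₀ + 1 ≤ R * ((ℓ + 1) * Mh) →
      ∀ (P : Fin (d + 1) → ℕ) (hP : ∀ μ, 1 ≤ P μ) (hP4 : ∀ μ, 4 ≤ P μ) (D : TDomains d ℓ Mh k P R) (a c : ℕ → ℝ),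
        (∀ i, 1 ≤ i → aminus ≤ a i ∧ a i ≤ aplus) → (∀ i, 1 ≤ i → a2minus ≤ c i ∧ c i ≤ a2plus) →
        (∀ i, 1 ≤ i → a (i + 1) = aNext ℓ (a i) (c i)) →
      ∀ (Kc : Fin (d + 1) → ℕ) [∀ i, NeZero (Kc i)], (∀ i, N0 ℓ Mh k P i = (ℓ + 1) ^ k * Kc i) →
      ∀ (c₀ : B13.Consts) (X : Finset (UT Kc)) (Rb : ℝ)
        (V : E → Matrix ↥(boxDom (N0 ℓ Mh k P)) ↥(boxDom (N0 ℓ Mh k P)) ℂ) (α₀ : ℝ) (α : Fin (d + 1) → ℝ) (ε μ cμ : ℝ),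
      (∀ i j, DifferentiableOn ℂ (fun u => V u i j) (ball (0 : E) Rb)) → 0 ≤ α₀ → (∀ ν, 0 ≤ α ν) →
      (∀ u ∈ ball (0 : E) Rb, ∀ (S : Matrix ↥(boxDom (N0 ℓ Mh k P)) ↥(boxDom (N0 ℓ Mh k P)) ℂ) (Y Y' : UT Kc),
        blockNorm (fun x : ↥(boxDom (N0 ℓ Mh k P)) => cubeML ℓ k Kc x.1)
            (fun x : ↥(boxDom (N0 ℓ Mh k P)) => cubeML ℓ k Kc x.1) (V u * S) Y Y' ≤
          α₀ * blockNorm (fun x : ↥(boxDom (N0 ℓ Mh k P)) => cubeML ℓ k Kc x.1)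
              (fun x : ↥(boxDom (N0 ℓ Mh k P)) => cubeML ℓ k Kc x.1) S Y Y' +
            ∑ ν, α ν * blockNorm (fun x : ↥(boxDom (N0 ℓ Mh k P)) => cubeML ℓ k Kc x.1)
              (fun x : ↥(boxDom (N0 ℓ Mh k P)) => cubeML ℓ k Kc x.1)
              ((((ℓ : ℂ) + 1) ^ k : ℂ) • (dT (N0 ℓ Mh k P) ν).map ((↑) : ℝ → ℂ) * S) Y Y') →
      0 ≤ μ → 2 * μ ≤ ε → 2 * μ ≤ δ₁ - ε - μ → 0 ≤ cμ →
      RowSum (toB6 (torusGeom Kc 0 0 0) 0 True) μ cμ →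
      cμ * (cμ * 1 * (1 * ((α₀ + ∑ ν, α ν * 1) * C)) * cμ) * cμ < 1 →
      ∃ (W : Type) (T : W → (TPt dd N' → ℂ) → E → Matrix ↥(boxDom (N0 ℓ Mh k P)) ↥(boxDom (N0 ℓ Mh k P)) ℂ)
        (SX' : Set W) (A' : W → ℝ) (D' : W → UT Kc → UT Kc → ℝ),
        BlockWalkExpansion c₀ (fun x : ↥(boxDom (N0 ℓ Mh k P)) => cubeML ℓ k Kc x.1)
          (fun x : ↥(boxDom (N0 ℓ Mh k P)) => cubeML ℓ k Kc x.1)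
          (fun (_ : TPt dd N' → ℂ) u =>
            ((((ℓ : ℂ) + 1) ^ (2 * k))⁻¹ : ℂ) • (gmlT (N0 ℓ Mh k P) ℓ k D.lev a).map ((↑) : ℝ → ℂ) *
              (1 - V u * (((((ℓ : ℂ) + 1) ^ (2 * k))⁻¹ : ℂ) • (gmlT (N0 ℓ Mh k P) ℓ k D.lev a).map ((↑) : ℝ → ℂ)))⁻¹)
          X Rb (ε - 2 * μ) (δ₁ - ε - μ - 2 * μ)
          (cμ * C * (1 * (1 - cμ * (cμ * 1 * (1 * ((α₀ + ∑ ν, α ν * 1) * C)) * cμ) * cμ)⁻¹) * cμ)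
          T SX' A' D' (δ₁ - 2 * μ) ∧
        (∀ (ν : Fin (d + 1)) ω (σ : TPt dd N' → ℂ), (∀ j, ‖σ j‖ ≤ Real.exp c₀.κ₁) → ∀ u ∈ ball (0 : E) Rb, ∀ Y Y',
          blockNorm (fun x : ↥(boxDom (N0 ℓ Mh k P)) => cubeML ℓ k Kc x.1)
              (fun x : ↥(boxDom (N0 ℓ Mh k P)) => cubeML ℓ k Kc x.1)
              ((((ℓ : ℂ) + 1) ^ k : ℂ) • (dT (N0 ℓ Mh k P) ν).map ((↑) : ℝ → ℂ) * T ω σ u) Y Y' ≤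
            1 * (A' ω * Real.exp (-((δ₁ - 2 * μ) * D' ω Y Y')))) ∧
        ∀ ω, DomBy (toB6 (torusGeom Kc 0 0 0) 0 True) (D' ω) := by
  obtain ⟨δ₁, C, M₀, N₀, hδ₁, hC, hM₀, hN₀, hflat⟩ :=
    flatLetters_multiLevelTorus_printUnits d ℓ hℓ aminus aplus a2minus a2plus ha ha2
  refine ⟨δ₁, C, M₀, N₀, hδ₁, hC, hM₀, hN₀, ?_⟩
  intro k Mh R hMh hM hR hRM P hP hP4 D a c haw hcw hac Kc _ hKc c₀ X Rb V α₀ α ε μ cμ hVan hα₀ hα hV hμ hμε hμκ hcμ hrow hq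
  have hletters := hflat k Mh R hMh hM hR hRM P hP hP4 D a c haw hcw hac Kc hKc
  -- the flat propagator `W = η²G′` as a one-term expansion at walk rate `δ₁`, window `ε`, torus rate `δ₁ − ε − μ`
  have hW := blockWalkExpansion_const (dd := dd) (N' := N') (E := E) c₀ (fun x : ↥(boxDom (N0 ℓ Mh k P)) => cubeML ℓ k Kc x.1)
    X (((((ℓ : ℂ) + 1) ^ (2 * k))⁻¹ : ℂ) • (gmlT (N0 ℓ Mh k P) ℓ k D.lev a).map ((↑) : ℝ → ℂ)) Rb
    (ε := ε) (κ := δ₁ - ε - μ) (ρ := δ₁) hC.le (by linarith) (fun Y Y' => (hletters Y Y').1)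
  -- its derivative letters, relative factor `1`
  have hD : ∀ (ν : Fin (d + 1)) (ω : Unit) (σ : TPt dd N' → ℂ), (∀ j, ‖σ j‖ ≤ Real.exp c₀.κ₁) → ∀ u ∈ ball (0 : E) Rb,
      ∀ Y Y' : UT Kc,
        blockNorm (fun x : ↥(boxDom (N0 ℓ Mh k P)) => cubeML ℓ k Kc x.1)
            (fun x : ↥(boxDom (N0 ℓ Mh k P)) => cubeML ℓ k Kc x.1)
            ((((ℓ : ℂ) + 1) ^ k : ℂ) • (dT (N0 ℓ Mh k P) ν).map ((↑) : ℝ → ℂ) *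
              (((((ℓ : ℂ) + 1) ^ (2 * k))⁻¹ : ℂ) • (gmlT (N0 ℓ Mh k P) ℓ k D.lev a).map ((↑) : ℝ → ℂ))) Y Y' ≤
          1 * (C * Real.exp (-(δ₁ * tdist1 Kc Y Y'))) := by
    intro ν _ σ _ u _ Y Y'
    rw [one_mul]
    exact (hletters Y Y').2 ν
  exact blockWalkExpansion_perturb_of_derivLetters
    (Dop := fun ν => (((ℓ : ℂ) + 1) ^ k : ℂ) • (dT (N0 ℓ Mh k P) ν).map ((↑) : ℝ → ℂ))
    (B := fun _ => (1 : ℝ)) hW (fun _ Y Y' => le_rfl) (fun _ => zero_le_one) hD hVan hα₀ hα hV hμ hμε hμκ (by linarith)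
    hC.le hcμ hrow hq

end Step

end Summit.QuantumFields.BalabanUV.Gaps.D4WalkBlockFlatMultiLevel

end
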